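import Summits.ABC.IUTFork.ForkBPS
import Summits.ABC.IUTFork.ForkLana
import HarnessLib

/-!
# The fork at [IUTchIII] Corollary 3.12, XV: LANA's main goal (9-1) at the level of its definition of `ℝ^ss`

Record-only file (D-0012) of the abc-iut cell's fork skeleton; TAKES NO SIDE. LANA's reformulation of the
disputed passage is the compatibility (9-1) `η_q = η^{anab}_S` (§9.2 p. 46) — "not manifestly false. However,
we, the LANA project, do not have a proof of (9-1) at this time" (§10.5 p. 49). `ForkLana.lean` recorded
its "real-number shadow" `OutputRegions.Represented` on the strength of LANA's gloss (§9.3 p. 46: "(9-1)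
indicates that … at the level of degree (log-volume), the rigidified `q`-pilot is represented in the output
regions"). This file types (9-1) ITSELF from the definitions printed on p. 46 and proves that the gloss is
a biconditional at that level:

`EtaSetting.mainGoal_iff_represented`: §9.2 p. 46 defines `ℝ^ss := {T ⊂ VC(I_v) | adelic and
  measurable}/∼`, "`T ∼ T′` if and only if the volume of `T` coincides with that of `T′`", pointed by the
  class of `M = 1·S` ("represents "LGP·S""), resp. (for `η_q`) by "the class of `{q̲_v O_v}`"; `η^{anab}_S`,
  `η_q : ℝ^val ⥲ ℝ^ss` are isomorphisms "of the pointed real vector spaces"; (9-1): "there exists some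
  suitable `S` such that `η_q = η^{anab}_S`". Typed: an isomorphism of pointed lines out of `ℝ^val` is
  determined by the image of the pilot (`PointedLine.linearEquiv_eq_of_pilot`), so (9-1) at the level of
  these definitions is the equality `[{q̲_v O_v}] = [1·S]` in `ℝ^ss` for some suitable `S`, i.e. (`mainGoal_iff_vol`)
  equality of VOLUMES, i.e. (`mainGoal_iff_represented`) the hypothesis `OutputRegions.Represented` of
  `ForkLana.lean` — which gives Cor. 3.12's inequality kernel-trivially (`cor312_of_mainGoal`; LANA p. 44:
  "We believe that if the problem described in the "main goal" below is solved, then Corollary 3.12 …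
  will follow"). What (9-1) carries BEYOND one real equality per `S` lives in the words "suitable `S`"
  (the orbit under (Ind1), (Ind2) and the (Ind3) upper bound: "the indeterminacies create ambiguities in
  the choice of the set `S` in (9-1)", §10.4 p. 49) and in the anabelian CONSTRUCTION of `η^{anab}_S`
  (§9.1 Steps 1–9) — the index type and the volume function, hypothesis data here; LANA §10.3 p. 48:
  "(9-1) asserts a comparison of two constructions before computing degrees".


Sources read on the page (nLab pdf of the report): pp. 44–49. Deliberately NOT here: volume containers
`VC(I_v)` (LLANA-SPEC N11), the `η`-algorithm (§9.1 Steps 1–9, N14), admissibility of `S`; any judgement.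
[cite: LANA2026Report, §9.2 p. 46, §9.3 p. 46, §10.3 p. 48]
-/

noncomputable section

namespace Summit.ABC

namespace IUTFork

/-! ## §9.2: `ℝ^ss`, the two pointings, and (9-1) -/

/-- An isomorphism of lines out of a pointed line is determined by the image of the pilot: "the
isomorphism `η^{anab}_S : ℝ^val ⥲ ℝ^ss` of the pointed real vector spaces" is pinned by where the pilot goes.
[cite: LANA2026Report, §9.2 p. 46] -/
theorem PointedLine.linearEquiv_eq_of_pilot (L : PointedLine) {M : Type} [AddCommGroup M] [Module ℝ M]
    (η η' : L.C ≃ₗ[ℝ] M) (h : η L.pilot = η' L.pilot) : η = η' := by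
  refine LinearEquiv.ext fun x => ?_
  obtain ⟨c, rfl⟩ := L.exists_smul_pilot x
  rw [map_smul, map_smul, h]

/-- LANA §9.2 p. 46: "`ℝ^ss = {T ⊂ VC(I_v) | adelic and measurable}/∼`, where `T ∼ T′` if and only if the
volume of `T` coincides with that of `T′`" — the quotient of a type of regions by equality of (log-)volume
(ABSTRACT version over any volume function; the measure-level `Rss` of `LanaRss.lean`, seat abc-iut-c312-4, is an instance).
[cite: LANA2026Report, §9.2 p. 46] -/
def AbsRss {Region : Type} (vol : Region → ℝ) : Type := Quotient (Setoid.ker vol)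

/-- Two regions have the same class in `ℝ^ss` iff they have the same volume. [cite: LANA2026Report, §9.2 p. 46] -/
theorem AbsRss.mk_eq_mk_iff {Region : Type} (vol : Region → ℝ) (T T' : Region) :
    (Quotient.mk (Setoid.ker vol) T : AbsRss vol) = Quotient.mk (Setoid.ker vol) T' ↔ vol T = vol T' :=
  ⟨fun h => Quotient.exact h, fun h => Quotient.sound h⟩

/-- The setting of §9.2 (hypothesis data): the pointed line `ℝ^val` ("the `C` part of the original BPS"),
the regions `T ⊂ VC(I_v)` with their volume (§5.2 (e): procession-normalised log-volume), the "suitable"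
integral structures `S` with the region `M = 1·S` ("represents "LGP·S"") — "suitable" = the orbit under
(Ind1), (Ind2) and the (Ind3) bound (§9.1 Step 9, §10.4 p. 49), not modelled —, the `q`-pilot region
"`{q̲_v O_v}` embedded "diagonally"", and the hull volume `−|log(Θ)|` bounding every `1·S` (§8.1 (f),(h)
p. 41; (Ind3) "an upper-bound constraint", §7.2 (c) p. 40). [cite: LANA2026Report, §9.2 p. 46] -/
structure EtaSetting where
  /-- `ℝ^val` -/
  Rval : PointedLine
  /-- adelic measurable regions `T ⊂ VC(I_v)` -/
  Region : Type
  /-- (log-)volume -/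
  vol : Region → ℝ
  /-- the suitable integral structures `S` -/
  S : Type
  /-- `S ↦ M = 1·S` ("LGP·S") -/
  LGP : S → Region
  /-- the `q`-pilot region `{q̲_v O_v}` -/
  qRegion : Region
  /-- `−|log(Θ)| = log-vol((U^{hol})^{det})` (§8.1 (h)) -/
  hull : ℝ
  /-- every admissible region lies in the hull; volume is monotone -/
  vol_LGP_le_hull : ∀ s, vol (LGP s) ≤ hull

namespace EtaSetting

variable (E : EtaSetting)

/-- **(9-1) at the level of §9.2's definitions**: "there exists some suitable `S` such that
`η_q = η^{anab}_S`" — both are isomorphisms of pointed lines `ℝ^val ⥲ ℝ^ss`, `η_q` pointing `ℝ^ss` by "the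
class of `{q̲_v O_v}`", `η^{anab}_S` by "the class of `M`" `= 1·S`; an isomorphism out of `ℝ^val` being
determined by the image of the pilot (`PointedLine.linearEquiv_eq_of_pilot`), equality of the two says: the
two classes in `ℝ^ss` coincide. HYPOTHESIS ("we … do not have a proof of (9-1) at this time", §10.5).
[cite: LANA2026Report, §9.2 (9-1) p. 46] -/
@[cite "LANA2026Report" "§9.2 (9-1) p. 46"] def MainGoal : Prop :=
  ∃ s : E.S, (Quotient.mk (Setoid.ker E.vol) E.qRegion : AbsRss E.vol) = Quotient.mk (Setoid.ker E.vol) (E.LGP s)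

/-- If `ℝ^ss` is realised inside ANY real vector space `M` by an injective class map `cls`, and `η_q`,
`η^{anab}_S : ℝ^val ⥲ M` are linear isomorphisms sending the pilot to `cls [q-region]`, resp. `cls [1·S]`,
then `η_q = η^{anab}_S ⟺ [q-region] = [1·S]`: the typed (9-1) does not depend on how the unprinted vector
space structure of `ℝ^ss` is chosen. [cite: LANA2026Report, §9.2 p. 46] -/
theorem eta_eq_iff {M : Type} [AddCommGroup M] [Module ℝ M] (cls : AbsRss E.vol → M)
    (hcls : Function.Injective cls) (s : E.S) (ηq ηS : E.Rval.C ≃ₗ[ℝ] M)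
    (hq : ηq E.Rval.pilot = cls (Quotient.mk _ E.qRegion))
    (hS : ηS E.Rval.pilot = cls (Quotient.mk _ (E.LGP s))) :
    ηq = ηS ↔ (Quotient.mk (Setoid.ker E.vol) E.qRegion : AbsRss E.vol) = Quotient.mk _ (E.LGP s) := by
  constructor
  · intro h
    apply hcls
    rw [← hq, ← hS, h]
  · intro h
    exact E.Rval.linearEquiv_eq_of_pilot ηq ηS (by rw [hq, hS, h])

/-- **(9-1) ⟺ equality of volumes**: `∃ S, vol({q̲_v O_v}) = vol(1·S)`. [cite: LANA2026Report, §9.2 p. 46] -/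
theorem mainGoal_iff_vol : E.MainGoal ↔ ∃ s : E.S, E.vol (E.LGP s) = E.vol E.qRegion := by
  simp only [MainGoal, AbsRss.mk_eq_mk_iff, eq_comm]

/-- The `OutputRegions` datum (`ForkLana`) of an `η`-setting: regions `1·S` with their volumes, the hull,
the `q`-pilot volume. [cite: LANA2026Report, §8.1 pp. 40–41] -/
def toOutputRegions : OutputRegions :=
  ⟨E.S, fun s => E.vol (E.LGP s), E.hull, E.vol_LGP_le_hull, E.vol E.qRegion⟩

/-- **(9-1), typed, IS `Represented`** — LANA §9.3 p. 46: "(9-1) indicates that … at the level of degree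
(log-volume), the rigidified `q`-pilot is represented in the output regions". With `ℝ^ss` as defined on p. 46
(regions modulo equal volume) this "indicates" is a biconditional. [cite: LANA2026Report, §9.3 p. 46] -/
theorem mainGoal_iff_represented : E.MainGoal ↔ E.toOutputRegions.Represented :=
  E.mainGoal_iff_vol

/-- Hence (9-1) gives Cor. 3.12's inequality `−|log(q)| ≤ −|log(Θ)|` (kernel-trivial: `ForkLana
cor312_of_represented` = [IUTchIII] Step (xi-f)) — LANA p. 44: "We believe that if the problem described in
the "main goal" below is solved, then Corollary 3.12 (and thus, in particular, the abc conjecture) will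
follow." At the typed level the implication is a theorem; the belief concerns what the types leave out
(that the `S` making (9-1) true is "suitable", i.e. admissible under (Ind1–3), and the volume of the hull).
[cite: LANA2026Report, §9 p. 44] -/
theorem cor312_of_mainGoal (h : E.MainGoal) : E.toOutputRegions.Cor312 :=
  E.toOutputRegions.cor312_of_represented (E.mainGoal_iff_represented.mp h)

end EtaSetting

end IUTFork

end Summit.ABC

end
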